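import Literature.NumberTheory.GaloisRepresentations.BrauerGroupCocycles
import Literature.NumberTheory.Automorphic.AdeleBaseChange
import Mathlib.NumberTheory.NumberField.Completion.FinitePlace
import Mathlib.NumberTheory.NumberField.Completion.LiesOverInstances
import HarnessLib

/-!
# Local triviality of a Brauer cocycle everywhere is preserved under finite base change

Topic `NumberTheory/GaloisRepresentations` (Galois cohomology of number fields: the localisation
maps `Br(K) → Br(K_v)` under base change); namespace `Literature.NumberTheory.GaloisRepresentations`.
Proof file: theorems only (no definition, no instance, no named fact; D-0026).

For an extension `K'/K` of number fields and a locally constant `2`-cocycle `e : Γ_K × Γ_K → K̄ˣ`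
(an explicit Brauer class, `BrauerGroupCocycles.lean`), the base change `e' = ι ∘ e ∘ (res × res)`
to `Γ_{K'}` is locally trivial at every place of `K'` as soon as `e` is locally trivial at every
place of `K` — the commutativity, up to the choice of embeddings (which is immaterial,
`exists_cob_pullback_iff_of_compatible`), of the square of restriction maps
`Br(K) → Br(K') → Br(K'_{w'})` and `Br(K) → Br(K_v) → Br(K'_{w'})` for `w' ∣ v`, through the local
base-change map `K_v → K'_{w'}` (the tree's `adicCompletionOfUnder` at the finite places, resp.
`infiniteCompletionOfComap` at the infinite places, `AdeleBaseChange.lean`):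

* `exists_cob_adicCompletion_baseChange` — finite places;
* `exists_cob_completion_baseChange` — infinite places.

## References

* J.-P. Serre, *Cohomologie galoisienne* / *Galois Cohomology* (1997), I §2.4 (compatible pairs
  and functoriality), II §1.1. [SerreGaloisCohomology1997]
* J. W. S. Cassels, A. Fröhlich (eds.), *Algebraic Number Theory* (1967), Ch. VII (Tate) §9.6
  ("local norm everywhere" under extension of the base). [CasselsFrohlichANT1967]
-/

noncomputable section

open NumberField IsDedekindDomain

universe u

namespace Literature.NumberTheory.GaloisRepresentations

open Field Literature.NumberTheory.Automorphic

variable {K : Type u} [Field K] [NumberField K] {K' : Type u} [Field K'] [NumberField K'] [Algebra K K']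

/-! ### Finite places -/

/-- **Local triviality at the finite places passes to a finite extension.**  Let `e` be a locally
constant `2`-cocycle `Γ_K × Γ_K → K̄ˣ` which becomes a coboundary over every completion `K_v`
(pulled back along `Γ_{K_v} → Γ_K`, pushed into `K̄_vˣ`).  Then its base change
`e'(x,y) = ι(e(res x, res y))` to `Γ_{K'}` becomes a coboundary over every completion `K'_{w'}`:
both `Γ_{K'_{w'}} → Γ_{K'} → Γ_K` and `Γ_{K'_{w'}} → Γ_{K_v} → Γ_K` (`v = w' ∩ K`, through the local
base change `K_v → K'_{w'}`) are compatible pairs from `(Γ_K, K̄ˣ)`, hence give cohomologous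
pull-backs (`exists_cob_pullback_iff_of_compatible`), and the second factors through the
coboundary over `K_v`. [cite: SerreGaloisCohomology1997, I §2.4, II §1.1] -/
theorem exists_cob_adicCompletion_baseChange
    (e : absoluteGaloisGroup K → absoluteGaloisGroup K → (AlgebraicClosure K)ˣ)
    (hlc : IsLocallyConstant fun p : absoluteGaloisGroup K × absoluteGaloisGroup K => e p.1 p.2)
    (hcoc : ∀ σ τ υ, e σ τ * e (σ * τ) υ = σ • e τ υ * e σ (τ * υ))
    (hfin : ∀ v : HeightOneSpectrum (𝓞 K),
      ∃ b : absoluteGaloisGroup (v.adicCompletion K) → (AlgebraicClosure (v.adicCompletion K))ˣ,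
        IsLocallyConstant b ∧ ∀ x y,
          Units.map (absClosureEmbedding K (v.adicCompletion K) :
              AlgebraicClosure K →* AlgebraicClosure (v.adicCompletion K))
            (e (absGaloisRestrict K (v.adicCompletion K) x) (absGaloisRestrict K (v.adicCompletion K) y)) =
          b x * x • b y / b (x * y))
    (w' : HeightOneSpectrum (𝓞 K')) :
    ∃ b : absoluteGaloisGroup (w'.adicCompletion K') → (AlgebraicClosure (w'.adicCompletion K'))ˣ,
      IsLocallyConstant b ∧ ∀ x y,
        Units.map (absClosureEmbedding K' (w'.adicCompletion K') :
            AlgebraicClosure K' →* AlgebraicClosure (w'.adicCompletion K'))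
          (Units.map (absClosureEmbedding K K' : AlgebraicClosure K →* AlgebraicClosure K')
            (e (absGaloisRestrict K K' (absGaloisRestrict K' (w'.adicCompletion K') x))
              (absGaloisRestrict K K' (absGaloisRestrict K' (w'.adicCompletion K') y)))) =
        b x * x • b y / b (x * y) := by
  classical
  set v : HeightOneSpectrum (𝓞 K) := w'.under (𝓞 K) with hv
  -- the local base change `K_v → K'_{w'}` and the towers through it
  letI alg : Algebra (v.adicCompletion K) (w'.adicCompletion K') := (adicCompletionOfUnder (𝓞 K) K K' w').toAlgebra
  haveI tower : IsScalarTower K (v.adicCompletion K) (w'.adicCompletion K') := by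
    refine IsScalarTower.of_algebraMap_eq fun x => ?_
    change ((algebraMap K K' x : K') : w'.adicCompletion K') =
      adicCompletionOfUnder (𝓞 K) K K' w' (x : v.adicCompletion K)
    rw [adicCompletionOfUnder_coe]
  haveI towerΩ : IsScalarTower K (v.adicCompletion K) (AlgebraicClosure (w'.adicCompletion K')) :=
    IsScalarTower.of_algebraMap_eq fun x => by
      rw [IsScalarTower.algebraMap_apply K (w'.adicCompletion K') (AlgebraicClosure (w'.adicCompletion K')) x,
        IsScalarTower.algebraMap_apply (v.adicCompletion K) (w'.adicCompletion K')
          (AlgebraicClosure (w'.adicCompletion K')),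
        ← IsScalarTower.algebraMap_apply K (v.adicCompletion K) (w'.adicCompletion K') x]
  -- pair 1: through `K'`
  let ι₁ : AlgebraicClosure K →ₐ[K] AlgebraicClosure (w'.adicCompletion K') :=
    ((absClosureEmbedding K' (w'.adicCompletion K')).restrictScalars K).comp (absClosureEmbedding K K')
  have hι₁ : ∀ u, Units.map (ι₁ : AlgebraicClosure K →* AlgebraicClosure (w'.adicCompletion K')) u =
      Units.map (absClosureEmbedding K' (w'.adicCompletion K') :
          AlgebraicClosure K' →* AlgebraicClosure (w'.adicCompletion K'))
        (Units.map (absClosureEmbedding K K' : AlgebraicClosure K →* AlgebraicClosure K') u) :=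
    fun u => Units.ext rfl
  have hr₁ : ∀ (x : absoluteGaloisGroup (w'.adicCompletion K')) (m : AlgebraicClosure K),
      ι₁ (absGaloisRestrict K K' (absGaloisRestrict K' (w'.adicCompletion K') x) • m) = x • ι₁ m := by
    intro x m
    change absClosureEmbedding K' (w'.adicCompletion K') (absClosureEmbedding K K' _) =
      x • absClosureEmbedding K' (w'.adicCompletion K') (absClosureEmbedding K K' m)
    rw [absGaloisRestrict_apply_smul, absGaloisRestrict_apply_smul]
  -- pair 2: through `K_v`
  let ι₂ : AlgebraicClosure K →ₐ[K] AlgebraicClosure (w'.adicCompletion K') :=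
    ((absClosureEmbedding (v.adicCompletion K) (w'.adicCompletion K')).restrictScalars K).comp
      (absClosureEmbedding K (v.adicCompletion K))
  have hι₂ : ∀ u, Units.map (ι₂ : AlgebraicClosure K →* AlgebraicClosure (w'.adicCompletion K')) u =
      Units.map (absClosureEmbedding (v.adicCompletion K) (w'.adicCompletion K') :
          AlgebraicClosure (v.adicCompletion K) →* AlgebraicClosure (w'.adicCompletion K'))
        (Units.map (absClosureEmbedding K (v.adicCompletion K) :
          AlgebraicClosure K →* AlgebraicClosure (v.adicCompletion K)) u) :=
    fun u => Units.ext rfl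
  have hr₂ : ∀ (x : absoluteGaloisGroup (w'.adicCompletion K')) (m : AlgebraicClosure K),
      ι₂ (absGaloisRestrict K (v.adicCompletion K)
        (absGaloisRestrict (v.adicCompletion K) (w'.adicCompletion K') x) • m) = x • ι₂ m := by
    intro x m
    change absClosureEmbedding (v.adicCompletion K) (w'.adicCompletion K')
        (absClosureEmbedding K (v.adicCompletion K) _) =
      x • absClosureEmbedding (v.adicCompletion K) (w'.adicCompletion K')
        (absClosureEmbedding K (v.adicCompletion K) m)
    rw [absGaloisRestrict_apply_smul, absGaloisRestrict_apply_smul]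
  -- pair 2 gives a coboundary: pull back the coboundary over `K_v`
  have h2 : ∃ b : absoluteGaloisGroup (w'.adicCompletion K') → (AlgebraicClosure (w'.adicCompletion K'))ˣ,
      IsLocallyConstant b ∧ ∀ x y,
        Units.map (ι₂ : AlgebraicClosure K →* AlgebraicClosure (w'.adicCompletion K'))
          (e (absGaloisRestrict K (v.adicCompletion K)
              (absGaloisRestrict (v.adicCompletion K) (w'.adicCompletion K') x))
            (absGaloisRestrict K (v.adicCompletion K)
              (absGaloisRestrict (v.adicCompletion K) (w'.adicCompletion K') y))) =
        b x * x • b y / b (x * y) := by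
    simp_rw [hι₂]
    refine exists_cob_pullback (F := v.adicCompletion K)
      (fun X Y => Units.map (absClosureEmbedding K (v.adicCompletion K) :
          AlgebraicClosure K →* AlgebraicClosure (v.adicCompletion K))
        (e (absGaloisRestrict K (v.adicCompletion K) X) (absGaloisRestrict K (v.adicCompletion K) Y)))
      (absGaloisRestrict (v.adicCompletion K) (w'.adicCompletion K') :
        absoluteGaloisGroup (w'.adicCompletion K') →* absoluteGaloisGroup (v.adicCompletion K))
      (absGaloisRestrict (v.adicCompletion K) (w'.adicCompletion K')).continuous
      (Units.map (absClosureEmbedding (v.adicCompletion K) (w'.adicCompletion K') :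
        AlgebraicClosure (v.adicCompletion K) →* AlgebraicClosure (w'.adicCompletion K')))
      (fun x a => Units.ext ?_) (hfin v)
    change absClosureEmbedding (v.adicCompletion K) (w'.adicCompletion K')
        ((absGaloisRestrict (v.adicCompletion K) (w'.adicCompletion K') x • a :
          (AlgebraicClosure (v.adicCompletion K))ˣ) : AlgebraicClosure (v.adicCompletion K)) =
      x • absClosureEmbedding (v.adicCompletion K) (w'.adicCompletion K') (a : AlgebraicClosure (v.adicCompletion K))
    rw [Units.coe_smul, absGaloisRestrict_apply_smul]
  -- transfer from pair 2 to the standard pair to pair 1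
  have hstd := (exists_cob_pullback_iff_of_compatible K (w'.adicCompletion K') e hlc hcoc ι₂ _ hr₂).mp h2
  have h1 := (exists_cob_pullback_iff_of_compatible K (w'.adicCompletion K') e hlc hcoc ι₁ _ hr₁).mpr hstd
  simp_rw [hι₁] at h1
  exact h1

/-! ### Infinite places -/

omit [NumberField K] [NumberField K'] in
/-- **Local triviality at the infinite places passes to a finite extension** (same argument
through the local base change `K_v → K'_{w'}` at the archimedean places, `v = w'|_K`).
[cite: SerreGaloisCohomology1997, I §2.4, II §1.1] -/
theorem exists_cob_completion_baseChange
    (e : absoluteGaloisGroup K → absoluteGaloisGroup K → (AlgebraicClosure K)ˣ)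
    (hlc : IsLocallyConstant fun p : absoluteGaloisGroup K × absoluteGaloisGroup K => e p.1 p.2)
    (hcoc : ∀ σ τ υ, e σ τ * e (σ * τ) υ = σ • e τ υ * e σ (τ * υ))
    (hinf : ∀ v : InfinitePlace K,
      ∃ b : absoluteGaloisGroup v.Completion → (AlgebraicClosure v.Completion)ˣ,
        IsLocallyConstant b ∧ ∀ x y,
          Units.map (absClosureEmbedding K v.Completion : AlgebraicClosure K →* AlgebraicClosure v.Completion)
            (e (absGaloisRestrict K v.Completion x) (absGaloisRestrict K v.Completion y)) =
          b x * x • b y / b (x * y))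
    (w' : InfinitePlace K') :
    ∃ b : absoluteGaloisGroup w'.Completion → (AlgebraicClosure w'.Completion)ˣ,
      IsLocallyConstant b ∧ ∀ x y,
        Units.map (absClosureEmbedding K' w'.Completion : AlgebraicClosure K' →* AlgebraicClosure w'.Completion)
          (Units.map (absClosureEmbedding K K' : AlgebraicClosure K →* AlgebraicClosure K')
            (e (absGaloisRestrict K K' (absGaloisRestrict K' w'.Completion x))
              (absGaloisRestrict K K' (absGaloisRestrict K' w'.Completion y)))) =
        b x * x • b y / b (x * y) := by
  classical
  set v : InfinitePlace K := w'.comap (algebraMap K K') with hv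
  letI alg : Algebra v.Completion w'.Completion := (infiniteCompletionOfComap K K' w').toAlgebra
  haveI tower : IsScalarTower K v.Completion w'.Completion := by
    refine IsScalarTower.of_algebraMap_eq fun x => ?_
    change ((algebraMap K K' x : K') : w'.Completion) = infiniteCompletionOfComap K K' w' (x : v.Completion)
    rw [infiniteCompletionOfComap_coe]
  haveI towerΩ : IsScalarTower K v.Completion (AlgebraicClosure w'.Completion) :=
    IsScalarTower.of_algebraMap_eq fun x => by
      rw [IsScalarTower.algebraMap_apply K w'.Completion (AlgebraicClosure w'.Completion) x,
        IsScalarTower.algebraMap_apply v.Completion w'.Completion (AlgebraicClosure w'.Completion),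
        ← IsScalarTower.algebraMap_apply K v.Completion w'.Completion x]
  haveI towerK' : IsScalarTower K K' w'.Completion := IsScalarTower.of_algebraMap_eq fun x => by
    apply InfinitePlace.Completion.ext
    simp [InfinitePlace.Completion.algebraMap_toCompletion, UniformSpace.Completion.algebraMap_def,
      WithAbs.algebraMap_right_apply, IsScalarTower.algebraMap_apply K K' (WithAbs w'.1)]
  let ι₁ : AlgebraicClosure K →ₐ[K] AlgebraicClosure w'.Completion :=
    ((absClosureEmbedding K' w'.Completion).restrictScalars K).comp (absClosureEmbedding K K')
  have hι₁ : ∀ u, Units.map (ι₁ : AlgebraicClosure K →* AlgebraicClosure w'.Completion) u =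
      Units.map (absClosureEmbedding K' w'.Completion : AlgebraicClosure K' →* AlgebraicClosure w'.Completion)
        (Units.map (absClosureEmbedding K K' : AlgebraicClosure K →* AlgebraicClosure K') u) :=
    fun u => Units.ext rfl
  have hr₁ : ∀ (x : absoluteGaloisGroup w'.Completion) (m : AlgebraicClosure K),
      ι₁ (absGaloisRestrict K K' (absGaloisRestrict K' w'.Completion x) • m) = x • ι₁ m := by
    intro x m
    change absClosureEmbedding K' w'.Completion (absClosureEmbedding K K' _) =
      x • absClosureEmbedding K' w'.Completion (absClosureEmbedding K K' m)
    rw [absGaloisRestrict_apply_smul, absGaloisRestrict_apply_smul]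
  let ι₂ : AlgebraicClosure K →ₐ[K] AlgebraicClosure w'.Completion :=
    ((absClosureEmbedding v.Completion w'.Completion).restrictScalars K).comp
      (absClosureEmbedding K v.Completion)
  have hι₂ : ∀ u, Units.map (ι₂ : AlgebraicClosure K →* AlgebraicClosure w'.Completion) u =
      Units.map (absClosureEmbedding v.Completion w'.Completion :
          AlgebraicClosure v.Completion →* AlgebraicClosure w'.Completion)
        (Units.map (absClosureEmbedding K v.Completion : AlgebraicClosure K →* AlgebraicClosure v.Completion) u) :=
    fun u => Units.ext rfl
  have hr₂ : ∀ (x : absoluteGaloisGroup w'.Completion) (m : AlgebraicClosure K),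
      ι₂ (absGaloisRestrict K v.Completion (absGaloisRestrict v.Completion w'.Completion x) • m) = x • ι₂ m := by
    intro x m
    change absClosureEmbedding v.Completion w'.Completion (absClosureEmbedding K v.Completion _) =
      x • absClosureEmbedding v.Completion w'.Completion (absClosureEmbedding K v.Completion m)
    rw [absGaloisRestrict_apply_smul, absGaloisRestrict_apply_smul]
  have h2 : ∃ b : absoluteGaloisGroup w'.Completion → (AlgebraicClosure w'.Completion)ˣ,
      IsLocallyConstant b ∧ ∀ x y,
        Units.map (ι₂ : AlgebraicClosure K →* AlgebraicClosure w'.Completion)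
          (e (absGaloisRestrict K v.Completion (absGaloisRestrict v.Completion w'.Completion x))
            (absGaloisRestrict K v.Completion (absGaloisRestrict v.Completion w'.Completion y))) =
        b x * x • b y / b (x * y) := by
    simp_rw [hι₂]
    refine exists_cob_pullback (F := v.Completion)
      (fun X Y => Units.map (absClosureEmbedding K v.Completion : AlgebraicClosure K →* AlgebraicClosure v.Completion)
        (e (absGaloisRestrict K v.Completion X) (absGaloisRestrict K v.Completion Y)))
      (absGaloisRestrict v.Completion w'.Completion : absoluteGaloisGroup w'.Completion →* absoluteGaloisGroup v.Completion)
      (absGaloisRestrict v.Completion w'.Completion).continuous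
      (Units.map (absClosureEmbedding v.Completion w'.Completion :
        AlgebraicClosure v.Completion →* AlgebraicClosure w'.Completion))
      (fun x a => Units.ext ?_) (hinf v)
    change absClosureEmbedding v.Completion w'.Completion
        ((absGaloisRestrict v.Completion w'.Completion x • a : (AlgebraicClosure v.Completion)ˣ) :
          AlgebraicClosure v.Completion) =
      x • absClosureEmbedding v.Completion w'.Completion (a : AlgebraicClosure v.Completion)
    rw [Units.coe_smul, absGaloisRestrict_apply_smul]
  have hstd := (exists_cob_pullback_iff_of_compatible K w'.Completion e hlc hcoc ι₂ _ hr₂).mp h2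
  have h1 := (exists_cob_pullback_iff_of_compatible K w'.Completion e hlc hcoc ι₁ _ hr₁).mpr hstd
  simp_rw [hι₁] at h1
  exact h1

end Literature.NumberTheory.GaloisRepresentations
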